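import Summits.AtomisticToContinuum.Crystallization.Theses.PalmUnimodularRigidity
import Summits.AtomisticToContinuum.Crystallization.Theorems.MinimiserShells.Negative.LoadBearing
import Summits.AtomisticToContinuum.Crystallization.Theorems.MinimiserShells.Negative.Rootedness
import Literature.Probability.Process.PointStationaryLaw
import Literature.MathematicalPhysics.StatisticalMechanics.RootEnergy
import Literature.MathematicalPhysics.StatisticalMechanics.MuGSC

/-!
# Palm density lemma — stub `stub_palmDensity` (S6) of line `equilibrium-in-law-surgery`,
# crux `MinimiserShells` (stmt-AtomisticToContinuum-9225)

Under a point-stationary `δ`-hard-core probability law `P` on rooted configurations of `ℝ³`,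
"few badly-shelled atoms everywhere" transfers to "the ROOT is almost surely well-shelled".
Precisely (`stub_palmDensity`): given a measurable set `B` of configurations that agrees with
`GoodShell` on every rooted hard-core counting measure (stub S5 of the line, taken as a
HYPOTHESIS here), if `P`-a.s. the configuration `μ = count|S` has at most `C R²` badly-shelled
atoms in the ball `B̄_R(0)` and at least `c R³` atoms in every ball `B̄_R(x)`, `x ∈ S`, for every
`R ≥ 1`, then `P`-a.s. `GoodShell μ`.

Proof (pure Palm theory, one mass transport, no energy). For `R ≥ 1` a bad root sends the mass
`1/μ(B̄_R(0))` to each of its atoms in `B̄_R(0)`: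
`g(μ, y) = 1_{Bᶜ}(μ) · 1[‖y‖ ≤ R] · μ(B̄_R(0))⁻¹` (jointly measurable, `measurable_transport`).
OUT-mass `= 1_{Bᶜ}(μ)` (`lintegral_transport`: the ball contains the root and finitely many atoms);
IN-mass `= Σ_{y ∈ S} 1[y bad, ‖y‖ ≤ R] / #(S ∩ B̄_R(y)) ≤ C R² / (c R³)`
(`lintegral_transport_map_le`); the Mecke identity gives `P(Bᶜ) ≤ C/(cR)` for every `R ≥ 1`
(`measure_compl_le`), whence `P(Bᶜ) = 0`, and on `B` the a.s. hard-core configuration is good.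
-/

noncomputable section

open MeasureTheory
open scoped ENNReal BigOperators

namespace Summit.AtomisticToContinuum.Crystallization.Theorems.PalmUnimodularRigidityMinimiserShells.PalmDensity

open Literature.Probability.Process (IsPointStationaryLaw IsRootedHardCore count_restrict_singleton_ne_zero_iff
  map_sub_count_restrict)
open Literature.MathematicalPhysics.StatisticalMechanics (lennardJones IsMuGSC UniformlyDiscrete)
open Summit.AtomisticToContinuum.Crystallization.Theses.PalmUnimodularRigidity (MinimiserShells UnimodularEnergyLowerBound)
open Summit.AtomisticToContinuum.Crystallization.Theorems.MinimiserShells.Negative.LoadBearing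
  (eStar meanRootEnergy GoodShell minimiserShells_iff)
open Summit.AtomisticToContinuum.Crystallization.Theorems.MinimiserShells.Negative.Rootedness
  (E3 countable_of_separated)

/-! ## Counting-measure bookkeeping (`E3 = EuclideanSpace ℝ (Fin 3)`, the abbrev of `Rootedness`) -/

/-- The counting measure of a finite set is its cardinality `Set.ncard`. -/
theorem count_eq_ncard {A : Set E3} (hA : A.Finite) :
    (Measure.count : Measure E3) A = ((A.ncard : ℕ) : ℝ≥0∞) := by
  rw [Measure.count_apply_finite A hA, Set.ncard_eq_toFinset_card A hA]

/-! ## The transport `g(μ, y) = 1_{Bᶜ}(μ) · 1[‖y‖ ≤ R] · μ(B̄_R(0))⁻¹` -/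

/-- The transport `g(μ, y) = 1_{Bᶜ}(μ) · 1[‖y‖ ≤ R] · μ(B̄_R(0))⁻¹` (a configuration outside `B`
spreads unit mass uniformly over its atoms in the closed `R`-ball about the root) is jointly
measurable, for measurable `B`. -/
theorem measurable_transport {B : Set (Measure E3)} (hB : MeasurableSet B) (R : ℝ) :
    Measurable (Function.uncurry fun (μ : Measure E3) (y : E3) =>
      Bᶜ.indicator (fun _ => (1 : ℝ≥0∞)) μ *
        (Metric.closedBall (0 : E3) R).indicator (fun _ => (1 : ℝ≥0∞)) y *
        (μ (Metric.closedBall (0 : E3) R))⁻¹) :=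
  (((measurable_const.indicator hB.compl).comp measurable_fst).mul
    ((measurable_const.indicator Metric.isClosed_closedBall.measurableSet).comp measurable_snd)).mul
    ((Measure.measurable_coe Metric.isClosed_closedBall.measurableSet).comp measurable_fst).inv

/-- **OUT-mass.** A rooted hard-core configuration sends out total mass `1_{Bᶜ}(μ)`: the ball
`B̄_R(0)`, `R ≥ 0`, contains the root (mass `≥ 1`) and finitely many atoms (mass `< ∞`). -/
theorem lintegral_transport (B : Set (Measure E3)) {R δ : ℝ} (hδ : 0 < δ) (hR : 0 ≤ R)
    {μ : Measure E3} (hμ : IsRootedHardCore δ μ) :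
    ∫⁻ y, Bᶜ.indicator (fun _ => (1 : ℝ≥0∞)) μ *
        (Metric.closedBall (0 : E3) R).indicator (fun _ => (1 : ℝ≥0∞)) y *
        (μ (Metric.closedBall (0 : E3) R))⁻¹ ∂μ = Bᶜ.indicator (fun _ => 1) μ := by
  have hK : MeasurableSet (Metric.closedBall (0 : E3) R) := Metric.isClosed_closedBall.measurableSet
  have hne : μ (Metric.closedBall (0 : E3) R) ≠ 0 := by
    have h1 : μ {0} ≤ μ (Metric.closedBall (0 : E3) R) :=
      measure_mono (Set.singleton_subset_iff.2 (Metric.mem_closedBall_self hR))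
    rw [hμ.measure_zero_singleton] at h1
    exact (zero_lt_one.trans_le h1).ne'
  have htop : μ (Metric.closedBall (0 : E3) R) ≠ ∞ := by
    obtain ⟨S, -, hsep, rfl⟩ := hμ
    rw [Measure.restrict_apply hK]
    refine (Measure.count_apply_lt_top.2 ?_).ne
    exact (UniformlyDiscrete.finite_inter_closedBall ⟨δ, hδ, hsep⟩ 0 R).subset
      fun z hz => ⟨hz.2, hz.1⟩
  have hmeas : Measurable fun y : E3 => Bᶜ.indicator (fun _ => (1 : ℝ≥0∞)) μ *
      (Metric.closedBall (0 : E3) R).indicator (fun _ => (1 : ℝ≥0∞)) y :=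
    measurable_const.mul (measurable_const.indicator hK)
  rw [lintegral_mul_const _ hmeas, lintegral_const_mul _ (measurable_const.indicator hK),
    lintegral_indicator_const hK, one_mul, mul_assoc, ENNReal.mul_inv_cancel hne htop, mul_one]

/-- **IN-mass bound.** For a rooted hard-core configuration `count|S` whose badly-shelled atoms in
`B̄_R(0)` number at most `C R²` and whose atom count in every `B̄_R(x)`, `x ∈ S`, is at least
`c R³` (`R ≥ 1`), the mass received at the root is at most `C R² / (c R³) = C / (c R)`: the atom
`y ∈ S` sends `1[y bad] · 1[‖y‖ ≤ R] / #(S ∩ B̄_R(y))` to the root (re-rooting at `y` is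
`map_sub_count_restrict`, it stays hard-core by `IsRootedHardCore.map_sub`, so `B` reads off
`GoodShell` there). -/
theorem lintegral_transport_map_le {B : Set (Measure E3)}
    (hB : ∀ δ : ℝ, 0 < δ → ∀ μ : Measure E3, IsRootedHardCore δ μ → (μ ∈ B ↔ GoodShell μ))
    {c C δ R : ℝ} (hc : 0 < c) (hδ : 0 < δ) (hR : 1 ≤ R) {S : Set E3}
    (hcore : IsRootedHardCore δ ((Measure.count : Measure E3).restrict S))
    (hbad : ({y ∈ S | dist y 0 ≤ R ∧ ¬ GoodShell ((Measure.count : Measure E3).restrict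
      ((fun z => z - y) '' S))}.ncard : ℝ) ≤ C * R ^ 2)
    (hvol : ∀ x ∈ S, c * R ^ 3 ≤ ({y ∈ S | dist y x ≤ R}.ncard : ℝ)) :
    ∫⁻ y, Bᶜ.indicator (fun _ => (1 : ℝ≥0∞))
          (Measure.map (fun z => z - y) ((Measure.count : Measure E3).restrict S)) *
        (Metric.closedBall (0 : E3) R).indicator (fun _ => (1 : ℝ≥0∞)) (-y) *
        ((Measure.map (fun z => z - y) ((Measure.count : Measure E3).restrict S))
          (Metric.closedBall (0 : E3) R))⁻¹ ∂((Measure.count : Measure E3).restrict S) ≤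
      ENNReal.ofReal (C / c * R⁻¹) := by
  obtain ⟨S', -, hsep, hSS'⟩ := id hcore
  obtain rfl : S = S' := Set.ext fun y => by
    rw [← count_restrict_singleton_ne_zero_iff S y, ← count_restrict_singleton_ne_zero_iff S' y, hSS']
  have hud : UniformlyDiscrete S := ⟨δ, hδ, hsep⟩
  have hSm : MeasurableSet S := (countable_of_separated hδ hsep).measurableSet
  have hK : MeasurableSet (Metric.closedBall (0 : E3) R) := Metric.isClosed_closedBall.measurableSet
  have hR0 : 0 < R := one_pos.trans_le hR
  set A : Set E3 := {y ∈ S | dist y 0 ≤ R ∧ ¬ GoodShell ((Measure.count : Measure E3).restrict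
      ((fun z => z - y) '' S))} with hA
  have hAfin : A.Finite :=
    (hud.finite_inter_closedBall 0 R).subset fun y hy => ⟨hy.1, Metric.mem_closedBall.2 hy.2.1⟩
  have hAm : MeasurableSet A := hAfin.measurableSet
  set K : ℝ≥0∞ := (ENNReal.ofReal (c * R ^ 3))⁻¹ with hKdef
  -- pointwise bound at every atom `y ∈ S`
  have hpt : ∀ y ∈ S,
      Bᶜ.indicator (fun _ => (1 : ℝ≥0∞))
          (Measure.map (fun z => z - y) ((Measure.count : Measure E3).restrict S)) *
        (Metric.closedBall (0 : E3) R).indicator (fun _ => (1 : ℝ≥0∞)) (-y) *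
        ((Measure.map (fun z => z - y) ((Measure.count : Measure E3).restrict S))
          (Metric.closedBall (0 : E3) R))⁻¹ ≤ A.indicator (fun _ => K) y := by
    intro y hy
    set ν : Measure E3 := Measure.map (fun z => z - y) ((Measure.count : Measure E3).restrict S)
      with hνdef
    have hν : ν = (Measure.count : Measure E3).restrict ((fun z => z - y) '' S) :=
      map_sub_count_restrict S y
    have hνcore : IsRootedHardCore δ ν :=
      hcore.map_sub ((count_restrict_singleton_ne_zero_iff S y).2 hy)
    have hνB : ν ∈ B ↔ GoodShell ν := hB δ hδ ν hνcore
    have hfin : {z ∈ S | dist z y ≤ R}.Finite :=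
      (hud.finite_inter_closedBall y R).subset fun z hz => ⟨hz.1, hz.2⟩
    have hνball :
        ν (Metric.closedBall (0 : E3) R) = (({z ∈ S | dist z y ≤ R}.ncard : ℕ) : ℝ≥0∞) := by
      rw [hνdef, Measure.map_apply (measurable_sub_const y) hK]
      have hpre : (fun z : E3 => z - y) ⁻¹' Metric.closedBall (0 : E3) R = Metric.closedBall y R := by
        ext z
        simp [dist_eq_norm]
      rw [hpre, Measure.restrict_apply Metric.isClosed_closedBall.measurableSet,
        show Metric.closedBall y R ∩ S = {z ∈ S | dist z y ≤ R} from
          Set.ext fun z => ⟨fun h => ⟨h.2, h.1⟩, fun h => ⟨h.2, h.1⟩⟩,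
        count_eq_ncard hfin]
    by_cases hyA : y ∈ A
    · rw [Set.indicator_of_mem hyA]
      calc Bᶜ.indicator (fun _ => (1 : ℝ≥0∞)) ν *
            (Metric.closedBall (0 : E3) R).indicator (fun _ => (1 : ℝ≥0∞)) (-y) *
            (ν (Metric.closedBall (0 : E3) R))⁻¹
          ≤ 1 * 1 * (ν (Metric.closedBall (0 : E3) R))⁻¹ :=
            mul_le_mul' (mul_le_mul' (Set.indicator_le_self _ _ _) (Set.indicator_le_self _ _ _)) le_rfl
        _ = (ν (Metric.closedBall (0 : E3) R))⁻¹ := by rw [one_mul, one_mul]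
        _ ≤ K := by
            rw [hνball, hKdef]
            refine ENNReal.inv_le_inv.2 ?_
            rw [← ENNReal.ofReal_natCast]
            exact ENNReal.ofReal_le_ofReal (hvol y hy)
    · rw [Set.indicator_of_notMem hyA]
      refine le_of_eq ?_
      have hnot : ¬ (dist y 0 ≤ R ∧ ¬ GoodShell ((Measure.count : Measure E3).restrict
          ((fun z => z - y) '' S))) := fun h => hyA ⟨hy, h⟩
      by_cases hd : dist y 0 ≤ R
      · have hgood : GoodShell ν := by
          rw [hν]
          by_contra hg
          exact hnot ⟨hd, hg⟩
        have hνBc : ν ∉ Bᶜ := fun h => h (hνB.2 hgood)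
        rw [Set.indicator_of_notMem hνBc, zero_mul, zero_mul]
      · have hyK : -y ∉ Metric.closedBall (0 : E3) R := fun h => hd (by
          rwa [Metric.mem_closedBall, dist_zero_right, norm_neg, ← dist_zero_right] at h)
        rw [Set.indicator_of_notMem hyK, mul_zero, zero_mul]
  -- integrate over the atoms
  calc ∫⁻ y, Bᶜ.indicator (fun _ => (1 : ℝ≥0∞))
            (Measure.map (fun z => z - y) ((Measure.count : Measure E3).restrict S)) *
          (Metric.closedBall (0 : E3) R).indicator (fun _ => (1 : ℝ≥0∞)) (-y) *
          ((Measure.map (fun z => z - y) ((Measure.count : Measure E3).restrict S))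
            (Metric.closedBall (0 : E3) R))⁻¹ ∂((Measure.count : Measure E3).restrict S)
      ≤ ∫⁻ y, A.indicator (fun _ => K) y ∂((Measure.count : Measure E3).restrict S) :=
        lintegral_mono_ae ((ae_restrict_iff' hSm).2 (Filter.Eventually.of_forall hpt))
    _ = K * (Measure.count : Measure E3) A := by
        rw [lintegral_indicator_const hAm, Measure.restrict_apply hAm,
          Set.inter_eq_left.2 (fun y hy => hy.1)]
    _ ≤ K * ENNReal.ofReal (C * R ^ 2) := by
        rw [count_eq_ncard hAfin, ← ENNReal.ofReal_natCast]
        exact mul_le_mul' le_rfl (ENNReal.ofReal_le_ofReal hbad)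
    _ = ENNReal.ofReal (C * R ^ 2 / (c * R ^ 3)) := by
        rw [ENNReal.ofReal_div_of_pos (by positivity), ENNReal.div_eq_inv_mul]
    _ = ENNReal.ofReal (C / c * R⁻¹) := by
        congr 1
        field_simp

/-- **Mecke step.** `P(Bᶜ) ≤ C / (c R)` for every `R ≥ 1`: by the Mecke identity applied to the
transport, the expected OUT-mass `P(Bᶜ)` equals the expected IN-mass, which is a.s. `≤ C/(cR)`. -/
theorem measure_compl_le {B : Set (Measure E3)} (hBm : MeasurableSet B)
    (hB : ∀ δ : ℝ, 0 < δ → ∀ μ : Measure E3, IsRootedHardCore δ μ → (μ ∈ B ↔ GoodShell μ))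
    {c C δ : ℝ} (hc : 0 < c) (hδ : 0 < δ) (P : Measure (Measure E3)) [IsProbabilityMeasure P]
    (hcore : ∀ᵐ μ ∂P, IsRootedHardCore δ μ) (hstat : IsPointStationaryLaw P)
    (hcount : ∀ᵐ μ ∂P, ∃ S : Set E3,
        μ = (Measure.count : Measure E3).restrict S ∧
        ∀ R : ℝ, 1 ≤ R →
          ({y ∈ S | dist y 0 ≤ R ∧ ¬ GoodShell ((Measure.count : Measure E3).restrict
              ((fun z => z - y) '' S))}.ncard : ℝ) ≤ C * R ^ 2 ∧
            ∀ x ∈ S, c * R ^ 3 ≤ ({y ∈ S | dist y x ≤ R}.ncard : ℝ))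
    {R : ℝ} (hR : 1 ≤ R) :
    P Bᶜ ≤ ENNReal.ofReal (C / c * R⁻¹) := by
  have hM := hstat _ (measurable_transport hBm R)
  have hL : ∫⁻ μ, ∫⁻ y, Bᶜ.indicator (fun _ => (1 : ℝ≥0∞)) μ *
      (Metric.closedBall (0 : E3) R).indicator (fun _ => (1 : ℝ≥0∞)) y *
      (μ (Metric.closedBall (0 : E3) R))⁻¹ ∂μ ∂P = P Bᶜ := by
    rw [← one_mul (P Bᶜ), ← lintegral_indicator_const hBm.compl]
    exact lintegral_congr_ae (hcore.mono fun μ hμ =>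
      lintegral_transport B hδ (zero_le_one.trans hR) hμ)
  calc P Bᶜ = _ := hL.symm
    _ = _ := hM
    _ ≤ ∫⁻ _, ENNReal.ofReal (C / c * R⁻¹) ∂P := by
        refine lintegral_mono_ae ?_
        filter_upwards [hcore, hcount] with μ hμ hS
        obtain ⟨S, rfl, hS⟩ := hS
        obtain ⟨hbad, hvol⟩ := hS R hR
        exact lintegral_transport_map_le hB hc hδ hR hμ hbad hvol
    _ = ENNReal.ofReal (C / c * R⁻¹) := by rw [lintegral_const, measure_univ, mul_one]

/-- **Palm density lemma** (stub `stub_palmDensity`, S6 of line `equilibrium-in-law-surgery` of crux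
`MinimiserShells`).  Given a measurable set `B` of configurations agreeing with `GoodShell` on rooted
hard-core counting measures: under a point-stationary `δ`-hard-core probability law almost surely
carried by configurations `count|S` with at most `C R²` badly-shelled atoms in `B̄_R(0)` and at least
`c R³` atoms in every `B̄_R(x)`, `x ∈ S` (`R ≥ 1`), the root shell is almost surely good.  One mass
transport: `P(Bᶜ) ≤ C/(cR)` for every `R ≥ 1` (`measure_compl_le`), so `P(Bᶜ) = 0` (`R → ∞`), and on
`B` the a.s. hard-core configuration has a good shell. -/
theorem stub_palmDensity :
    (∃ B : Set (Measure (EuclideanSpace ℝ (Fin 3))), MeasurableSet B ∧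
      ∀ δ : ℝ, 0 < δ → ∀ μ : Measure (EuclideanSpace ℝ (Fin 3)), IsRootedHardCore δ μ → (μ ∈ B ↔ GoodShell μ)) →
    ∀ c C : ℝ, 0 < c → ∀ δ : ℝ, 0 < δ → ∀ P : Measure (Measure (EuclideanSpace ℝ (Fin 3))),
      IsProbabilityMeasure P → (∀ᵐ μ ∂P, IsRootedHardCore δ μ) → IsPointStationaryLaw P →
      (∀ᵐ μ ∂P, ∃ S : Set (EuclideanSpace ℝ (Fin 3)),
          μ = (Measure.count : Measure (EuclideanSpace ℝ (Fin 3))).restrict S ∧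
          ∀ R : ℝ, 1 ≤ R →
            ({y ∈ S | dist y 0 ≤ R ∧ ¬ GoodShell ((Measure.count : Measure (EuclideanSpace ℝ (Fin 3))).restrict
                ((fun z => z - y) '' S))}.ncard : ℝ) ≤ C * R ^ 2 ∧
              ∀ x ∈ S, c * R ^ 3 ≤ ({y ∈ S | dist y x ≤ R}.ncard : ℝ)) →
      ∀ᵐ μ ∂P, GoodShell μ := by
  rintro ⟨B, hBm, hB⟩ c C hc δ hδ P hP hcore hstat hcount
  have hlim : Filter.Tendsto (fun R : ℝ => ENNReal.ofReal (C / c * R⁻¹)) Filter.atTop (nhds 0) := by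
    have h := ENNReal.tendsto_ofReal (tendsto_inv_atTop_zero.const_mul (C / c))
    rwa [mul_zero, ENNReal.ofReal_zero] at h
  have hPB : P Bᶜ = 0 := by
    refine le_antisymm (ge_of_tendsto hlim ?_) bot_le
    filter_upwards [Filter.eventually_ge_atTop (1 : ℝ)] with R hR
    exact measure_compl_le hBm hB hc hδ P hcore hstat hcount hR
  have hmem : ∀ᵐ μ ∂P, μ ∈ B := by
    rw [ae_iff]
    exact hPB
  filter_upwards [hcore, hmem] with μ hμ hμB
  exact (hB δ hδ μ hμ).1 hμB

end Summit.AtomisticToContinuum.Crystallization.Theorems.PalmUnimodularRigidityMinimiserShells.PalmDensity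

end
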